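import Summits.PneNP.PneNP.Theorems.ConvexRankGatesConvexGateBlindExactLiftingTriangleJump

/-!
# Triangle instance — CORRECTION: the termwise rigidity hypothesis "R1" of `…TriangleJump` is unsatisfiable

Support file for crux `ConvexGateBlind` (stmt-PneNP-10680), open stub `stub_exactLifting`; prover seat 0, session 35
(correcting session 28, memo ANALYSIS13 §2 / this session's memo ANALYSIS14 §1).

`…TriangleJump` reduced the first ε-uniform strict-rank jump on the triangle matrix `M_t[x,w] = monoCount x w` to the
hypothesis `hR` of `jump_of_lineRigid` ("R1"): every `3t²`-term non-negative factorisation of `M_t` is the line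
factorisation TERM BY TERM, `u_L(x)·v_L(w) = [σL mono_x]·[w ∈ σL]`, for ALL rows `x`. THAT HYPOTHESIS IS FALSE for every
`t ≥ 2` (`not_lineRigid`, and `triangle_rigidity_hypothesis_false` for the verbatim hypothesis of the registered
`triangle_jump_of_rigidity`), so those two theorems are vacuous as stated. Reason: on a DEGENERATE row — a colouring under
which some block is monochromatic, e.g. `x₂ ≡ false` — the representation of the row `M_x` as a non-negative combination of
line indicators is NOT unique: the plane relation `∑_b 1_{(a,b,·)} = ∑_d 1_{(a,·,d)}` lets one move the weight of the `t`
monochromatic lines `{(p,b,·)}` (`b ∈ [t]`) onto the lines `{(p,·,d)}` (`d ∈ [t]`). Keeping the `3t²` line indicators as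
column functions and changing the usage on that single row gives a second `3t²`-term non-negative factorisation of `M_t`
(`isNMF_udeg`) which is not a relabelling of the line factorisation.

What survives (memo ANALYSIS14): on NONDEGENERATE rows (every block `2`-coloured) the line representation IS unique
(file `…TriangleLineRepUnique`), the isolation theorem needs closeness only on nondegenerate rows (files `…IsolationND*`),
and the bridge holds with the corrected hypothesis R1′ = GENERATOR rigidity (file `…TriangleJumpGen`).
-/

set_option linter.dupNamespace false -- `Summit.PneNP.PneNP.…`: summit = sub-problem (D-0017)

namespace Summit.PneNP.PneNP.Theorems.XorDoor.TriLine

open Finset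

noncomputable section

variable {t : ℕ}

/-! ## Sums against line indicators -/

/-- summing a function of lines against the indicators of the lines through `w` picks the three lines through `w` -/
lemma sum_mul_lind_eq_three (c : Line t → ℝ) (w : Tri t) :
    ∑ L : Line t, c L * lind L w
      = c (Sum.inl (w.1, w.2.1)) + c (Sum.inr (Sum.inl (w.1, w.2.2))) + c (Sum.inr (Sum.inr (w.2.1, w.2.2))) := by
  obtain ⟨a, b, d⟩ := w
  show _ = c (Sum.inl (a, b)) + c (Sum.inr (Sum.inl (a, d))) + c (Sum.inr (Sum.inr (b, d)))
  have key : ∀ (f : Fin t × Fin t → ℝ) (p q : Fin t) (P : Fin t × Fin t → Prop) [DecidablePred P],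
      (∀ pq, P pq ↔ (p = pq.1 ∧ q = pq.2)) → ∑ pq, f pq * (if P pq then (1 : ℝ) else 0) = f (p, q) := by
    intro f p q P _ hP
    rw [Fintype.sum_eq_single (p, q)]
    · rw [if_pos ((hP _).2 ⟨rfl, rfl⟩), mul_one]
    · rintro ⟨p', q'⟩ hne
      rw [if_neg, mul_zero]
      intro hP'
      obtain ⟨rfl, rfl⟩ := (hP _).1 hP'
      exact hne rfl
  rw [Fintype.sum_sum_type, Fintype.sum_sum_type]
  unfold lind
  rw [key _ a b _ (fun pq => lmem_inl pq (a, b, d)), key _ a d _ (fun pq => lmem_inr_inl pq (a, b, d)),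
    key _ b d _ (fun pq => lmem_inr_inr pq (a, b, d))]
  ring

/-- the canonical line representation of a row: `∑_L [L mono_x]·1_L(w) = monoCount x w` -/
lemma sum_mInd_mul_lind (x : Col t) (w : Tri t) : ∑ L : Line t, mInd x L * lind L w = (monoCount x w : ℝ) := by
  rw [monoCount_eq_sum_lines]
  refine sum_congr rfl fun L _ => ?_
  unfold mInd lind
  by_cases hm : lmono x L <;> by_cases hl : lmem L w <;> simp [hm, hl]

/-! ## The second factorisation -/

/-- the degenerate row: block `2` all `false`; in blocks `1` and `3` the vertex `p` is `false` and the others `true` -/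
def xdeg (p : Fin t) : Col t := (fun a => decide (a ≠ p), fun _ => false, fun d => decide (d ≠ p))

/-- the change of usage on the degenerate row: `−1` on the lines `{(p,b,·)}`, `+1` on the lines `{(p,·,d)}` -/
def ddeg (p : Fin t) : Line t → ℝ :=
  Sum.elim (fun ab => if ab.1 = p then -1 else 0) (Sum.elim (fun ad => if ad.1 = p then 1 else 0) (fun _ => 0))

/-- the modified usage: the line pattern on every row except `xdeg p`, where the plane relation has been applied -/
def udeg (p : Fin t) (L : Line t) (x : Col t) : ℝ :=
  if x = xdeg p then mInd (xdeg p) L + ddeg p L else mInd x L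

/-- the plane relation: the change of usage is invisible in the product -/
lemma sum_ddeg_mul_lind (p : Fin t) (w : Tri t) : ∑ L : Line t, ddeg p L * lind L w = 0 := by
  rw [sum_mul_lind_eq_three]
  simp only [ddeg, Sum.elim_inl, Sum.elim_inr]
  split_ifs <;> norm_num

/-- the lines `{(p,b,·)}` are monochromatic under the degenerate row (both fixed vertices are `false`) -/
lemma mInd_xdeg_inl (p b : Fin t) : mInd (xdeg p) (Sum.inl (p, b)) = 1 := by
  unfold mInd; rw [if_pos]; simp [xdeg]

/-- the modified usage is non-negative -/
lemma udeg_nonneg (p : Fin t) (L : Line t) (x : Col t) : 0 ≤ udeg p L x := by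
  have hm : ∀ (y : Col t) (L' : Line t), 0 ≤ mInd y L' := fun y L' => by unfold mInd; split_ifs <;> norm_num
  unfold udeg
  split_ifs with hx
  · rcases L with ⟨a, b⟩ | ⟨a, d⟩ | ⟨b, d⟩
    · by_cases ha : a = p
      · subst ha; rw [mInd_xdeg_inl]; simp [ddeg]
      · simpa [ddeg, ha] using hm (xdeg p) (Sum.inl (a, b))
    · have := hm (xdeg p) (Sum.inr (Sum.inl (a, d)))
      simp only [ddeg, Sum.elim_inr, Sum.elim_inl]
      split_ifs <;> linarith
    · simpa [ddeg] using hm (xdeg p) (Sum.inr (Sum.inr (b, d)))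
  · exact hm x L

/-- **A second `3t²`-term non-negative factorisation of `M_t`**: the line indicators as column functions, the line pattern
as usage on every row except the degenerate row `xdeg p`, where the weight of the lines `{(p,b,·)}` sits on `{(p,·,d)}`. -/
theorem isNMF_udeg (p : Fin t) : IsNMF t 0 (udeg p) (fun L w => lind L w) := by
  refine ⟨fun L x => udeg_nonneg p L x, fun L w => lind_nonneg L w, fun x w => ?_⟩
  rw [sub_zero]
  unfold udeg
  split_ifs with hx
  · subst hx
    simp only [add_mul, sum_add_distrib, sum_ddeg_mul_lind, add_zero]
    exact sum_mInd_mul_lind _ w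
  · exact sum_mInd_mul_lind x w

/-- **The termwise rigidity hypothesis R1 is false** (`t ≥ 2`, witnessed by two distinct vertices `p ≠ q`): it is NOT the
case that every non-negative factorisation of `M_t` indexed by the lines is, up to a permutation of the indices, the line
factorisation term by term. (The hypothesis `hR` of `jump_of_lineRigid` / `jump_of_lineRigid_fin` is unsatisfiable.) -/
theorem not_lineRigid {p q : Fin t} (hpq : p ≠ q) :
    ¬ ∀ (u : Line t → Col t → ℝ) (v : Line t → Tri t → ℝ), IsNMF t 0 u v →
      ∃ σ : Equiv.Perm (Line t), ∀ L x w, u L x * v L w = mInd x (σ L) * lind (σ L) w := by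
  intro h
  obtain ⟨σ, hσ⟩ := h (udeg p) (fun L w => lind L w) (isNMF_udeg p)
  -- the all-`false` row is not the degenerate row (they differ at the vertex `q` of block `1`)
  have hne : col0 t ≠ xdeg p := by
    intro h0
    have := congrArg (fun x : Col t => x.1 q) h0
    simp [col0, xdeg, hpq.symm] at this
  -- under the all-`false` row the term of `L₀ = {(p,p,·)}` is `1_{L₀}`, so `σ L₀` has the same indicator
  have h1 : ∀ w, lind (Sum.inl (p, p)) w = lind (σ (Sum.inl (p, p))) w := by
    intro w
    have := hσ (Sum.inl (p, p)) (col0 t) w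
    rwa [udeg, if_neg hne, mInd_col0, mInd_col0, one_mul, one_mul] at this
  -- under the degenerate row the usage of `L₀` is `0`
  have h2 : ∀ w, mInd (xdeg p) (σ (Sum.inl (p, p))) * lind (σ (Sum.inl (p, p))) w = 0 := by
    intro w
    have := hσ (Sum.inl (p, p)) (xdeg p) w
    rw [udeg, if_pos rfl, mInd_xdeg_inl] at this
    simpa [ddeg] using this.symm
  have hp1 : lind (σ (Sum.inl (p, p))) (p, p, p) = 1 := by rw [← h1]; exact lind_of_lmem (by simp)
  have hq1 : lind (σ (Sum.inl (p, p))) (p, p, q) = 1 := by rw [← h1]; exact lind_of_lmem (by simp)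
  have hmp : lmem (σ (Sum.inl (p, p))) (p, p, p) := by
    by_contra hc; rw [lind_of_not_lmem hc] at hp1; exact zero_ne_one hp1
  have hmq : lmem (σ (Sum.inl (p, p))) (p, p, q) := by
    by_contra hc; rw [lind_of_not_lmem hc] at hq1; exact zero_ne_one hq1
  have h3 := h2 (p, p, p)
  rw [hp1, mul_one] at h3
  rcases hL : σ (Sum.inl (p, p)) with ⟨a, b⟩ | ⟨a, d⟩ | ⟨b, d⟩
  · rw [hL] at hmp h3
    simp only [lmem_inl] at hmp
    obtain ⟨rfl, rfl⟩ := hmp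
    rw [mInd_xdeg_inl] at h3
    exact one_ne_zero h3
  · rw [hL] at hmp hmq
    simp only [lmem_inr_inl] at hmp hmq
    exact hpq (hmp.2.trans hmq.2.symm)
  · rw [hL] at hmp hmq
    simp only [lmem_inr_inr] at hmp hmq
    exact hpq (hmp.2.trans hmq.2.symm)

/-- **The hypothesis of the registered `triangle_jump_of_rigidity` is false for every `t ≥ 2`** (verbatim hypothesis,
self-contained vocabulary): termwise uniqueness of the line factorisation of `M_t` up to relabelling fails, because of
the degenerate rows. So `triangle_jump_of_rigidity` (and `jump_of_lineRigid`, `jump_of_lineRigid_fin`) hold vacuously and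
reduce nothing; the corrected reduction is `…TriangleJumpGen`. -/
theorem triangle_rigidity_hypothesis_false : ∀ (t : ℕ), 2 ≤ t → ¬ ∀ (u : (Fin t × Fin t) ⊕ (Fin t × Fin t) ⊕ (Fin t
    × Fin t) → (Fin t → Bool) × (Fin t → Bool) × (Fin t → Bool) → ℝ) (v : (Fin t × Fin t) ⊕ (Fin t × Fin t) ⊕ (Fin t
    × Fin t) → Fin t × Fin t × Fin t → ℝ), (∀ L x, 0 ≤ u L x) → (∀ L w, 0 ≤ v L w) → (∀ x w, ∑ L, u L x * v L w = ((if
    x.1 w.1 = x.2.1 w.2.1 then 1 else 0) + (if x.1 w.1 = x.2.2 w.2.2 then 1 else 0) + (if x.2.1 w.2.1 = x.2.2 w.2.2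
    then 1 else 0) : ℝ)) → ∃ σ : Equiv.Perm ((Fin t × Fin t) ⊕ (Fin t × Fin t) ⊕ (Fin t × Fin t)), ∀ L x w, u L x * v
    L w = Sum.elim (fun ab : Fin t × Fin t => if x.1 ab.1 = x.2.1 ab.2 then (1 : ℝ) else 0) (Sum.elim (fun ad : Fin t
    × Fin t => if x.1 ad.1 = x.2.2 ad.2 then (1 : ℝ) else 0) (fun bd : Fin t × Fin t => if x.2.1 bd.1 = x.2.2 bd.2
    then (1 : ℝ) else 0)) (σ L) * Sum.elim (fun ab : Fin t × Fin t => if w.1 = ab.1 ∧ w.2.1 = ab.2 then (1 : ℝ) else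
    0) (Sum.elim (fun ad : Fin t × Fin t => if w.1 = ad.1 ∧ w.2.2 = ad.2 then (1 : ℝ) else 0) (fun bd : Fin t × Fin t
    => if w.2.1 = bd.1 ∧ w.2.2 = bd.2 then (1 : ℝ) else 0)) (σ L) := by
  intro t ht hR
  have hpq : (⟨0, by omega⟩ : Fin t) ≠ ⟨1, by omega⟩ := by simp [Fin.ext_iff]
  refine not_lineRigid hpq fun u v h => ?_
  obtain ⟨σ, hσ⟩ := hR u v h.u_nonneg h.v_nonneg fun x w => by
    rw [h.fact x w, sub_zero]; simp only [monoCount]; push_cast; ring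
  refine ⟨σ, fun L x w => ?_⟩
  rw [hσ L x w, mInd_eq_elim, lind_eq_elim]

end

end Summit.PneNP.PneNP.Theorems.XorDoor.TriLine
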